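import Mathlib
import HarnessLib
import Literature.AlgebraicGeometry.Resolution.KiralyLutkebohmertCriterionProofs
import Summits.ResolutionOfSingularities.ResolutionOfSingularities.Theorems.WildQuotientsWildQuotientResolutionS1aOneShotKill

/-!
# S1a — (T2e, steps e1/e2) LOCALISING THE KILL: augmentation ideals commute with localisation; K–L at a stable prime

[OURS · L1 W4.5c · lead-1 g6; plan-1 T2-THEOREM-SHEET §11 (e1)(e2)] — NOT statements of the manuscript; counted 0; AI-level work,
weaker than expert review. Crux stmt-ResolutionOfSingularities-17941, line `s1a-logminvertex` v6, stub `stub_winningStrategy` ((R0) branch,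
consumer chain of the one-shot kill).

For an automorphism `σ` of `R` preserving a submonoid `M` and the induced automorphism
`σ_S = IsLocalization.ringEquivOfRingEquiv S S σ H` of a localisation `S = R[M⁻¹]`:
* `ringEquivOfRingEquiv_iterate_algebraMap`, `ringEquivOfRingEquiv_iterate_eq_self` — `σ^[p] = id ⇒ σ_S^[p] = id`;
* `augmentationIdeal_ringEquivOfRingEquiv` — **(e1)** `augmentationIdeal σ_S = (augmentationIdeal σ)·S`;
* `isRegularLocalRing_invariantSubring_atPrime` — **(e2, stable prime)**: `C` a regular ring, `τ` of prime order `p` with PRINCIPAL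
  augmentation ideal (the one-shot kill `…S1aOneShotKillChart(Shift)`), `𝔭` a `τ`-stable prime ⇒ the ring of invariants of `τ` on `C_𝔭`
  is a regular local ring (Király–Lütkebohmert `KiralyLutkebohmertRegularity_holds`, or trivially if `τ` acts trivially on `C_𝔭`).
What is still missing for (e2) global: the `τ`-MOVED primes (free-quotient étaleness, `Literature…FreeQuotientEtale`) and «invariants of
the localisation = localisation of the invariants».
-/

set_option linter.dupNamespace false

noncomputable section

open Literature.AlgebraicGeometry.Resolution

namespace Summit.ResolutionOfSingularities.ResolutionOfSingularities.Theorems.WildQuotientResolution.S1.OneShotKill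

universe u

section Localise

variable {R : Type u} [CommRing R] {M : Submonoid R} {S : Type u} [CommRing S] [Algebra R S] [IsLocalization M S]
  (σ : R ≃+* R) (H : M.map σ.toMonoidHom = M)

/-- Iterates of the induced automorphism on the image of `R`. -/
theorem ringEquivOfRingEquiv_iterate_algebraMap (k : ℕ) (r : R) :
    (IsLocalization.ringEquivOfRingEquiv S S σ H)^[k] (algebraMap R S r) = algebraMap R S (σ^[k] r) := by
  induction k generalizing r with
  | zero => rfl
  | succ k ih =>
    rw [Function.iterate_succ_apply, Function.iterate_succ_apply, IsLocalization.ringEquivOfRingEquiv_eq, ih]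

/-- **`σ^[p] = id ⇒ σ_S^[p] = id`.** -/
theorem ringEquivOfRingEquiv_iterate_eq_self {p : ℕ} (hσp : ∀ r : R, σ^[p] r = r) (x : S) :
    (IsLocalization.ringEquivOfRingEquiv S S σ H)^[p] x = x := by
  obtain ⟨r, m, rfl⟩ := IsLocalization.exists_mk'_eq M x
  have hU : IsUnit (algebraMap R S (m : R)) := IsLocalization.map_units S m
  have hspec : IsLocalization.mk' S r m * algebraMap R S (m : R) = algebraMap R S r := IsLocalization.mk'_spec S r m
  have key : (IsLocalization.ringEquivOfRingEquiv S S σ H)^[p] (IsLocalization.mk' S r m) * algebraMap R S (m : R) =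
      algebraMap R S r := by
    have := congrArg (fun y => (IsLocalization.ringEquivOfRingEquiv S S σ H)^[p] y) hspec
    rw [iterate_map_mul, ringEquivOfRingEquiv_iterate_algebraMap,
      ringEquivOfRingEquiv_iterate_algebraMap, hσp, hσp] at this
    exact this
  exact hU.mul_left_injective (key.trans hspec.symm)

/-- **(e1) Augmentation ideals commute with localisation**: `I_{σ_S} = I_σ · S`. [OURS · L1 W4.5c] -/
theorem augmentationIdeal_ringEquivOfRingEquiv :
    augmentationIdeal (IsLocalization.ringEquivOfRingEquiv S S σ H) = (augmentationIdeal σ).map (algebraMap R S) := by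
  refine le_antisymm ?_ (map_augmentationIdeal_le σ _ fun r => IsLocalization.ringEquivOfRingEquiv_eq H r)
  rw [augmentationIdeal, Ideal.span_le]
  rintro _ ⟨x, rfl⟩
  obtain ⟨r, m, rfl⟩ := IsLocalization.exists_mk'_eq M x
  have hm : σ (m : R) ∈ M := by
    have : σ.toMonoidHom (m : R) ∈ M.map σ.toMonoidHom := Submonoid.mem_map_of_mem _ m.2
    rw [H] at this
    exact this
  have hU : IsUnit (algebraMap R S (m : R) * algebraMap R S (σ m)) :=
    (IsLocalization.map_units S m).mul (IsLocalization.map_units S ⟨σ m, hm⟩)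
  rw [SetLike.mem_coe, ← Ideal.mul_unit_mem_iff_mem _ hU]
  have h1 : IsLocalization.mk' S r m * algebraMap R S (m : R) = algebraMap R S r := IsLocalization.mk'_spec S r m
  have h2 : IsLocalization.ringEquivOfRingEquiv S S σ H (IsLocalization.mk' S r m) * algebraMap R S (σ m) =
      algebraMap R S (σ r) := by
    have := congrArg (IsLocalization.ringEquivOfRingEquiv S S σ H) h1
    rwa [map_mul, IsLocalization.ringEquivOfRingEquiv_eq, IsLocalization.ringEquivOfRingEquiv_eq] at this
  have key : (IsLocalization.ringEquivOfRingEquiv S S σ H (IsLocalization.mk' S r m) - IsLocalization.mk' S r m) *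
      (algebraMap R S (m : R) * algebraMap R S (σ m)) =
      algebraMap R S ((σ r - r) * m - r * (σ m - m)) := by
    rw [map_sub, map_mul, map_mul, map_sub, map_sub]
    linear_combination (algebraMap R S (m : R)) * h2 - (algebraMap R S (σ (m : R))) * h1
  rw [key]
  exact Ideal.mem_map_of_mem _ (Ideal.sub_mem _ (Ideal.mul_mem_right _ _ (sub_mem_augmentationIdeal σ r))
    (Ideal.mul_mem_left _ _ (sub_mem_augmentationIdeal σ (m : R))))

end Localise

section StablePrime

variable {C : Type u} [CommRing C] (τ : C ≃+* C) (𝔭 : Ideal C) [𝔭.IsPrime]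
  (H : 𝔭.primeCompl.map τ.toMonoidHom = 𝔭.primeCompl)

/-- **(e2, stable prime) the invariants of the localised kill are regular**: `C` regular, `τ` of prime order `p` with principal
augmentation ideal, `𝔭` a `τ`-stable prime ⇒ `(C_𝔭)^{τ}` (invariants of the induced automorphism of `C_𝔭`) is a regular local ring.
[OURS · L1 W4.5c] -/
theorem isRegularLocalRing_invariantSubring_atPrime [IsRegularRing C] {p : ℕ} (hp : p.Prime)
    (hτp : ∀ x : C, τ^[p] x = x) (hI : (augmentationIdeal τ).IsPrincipal) :
    IsRegularLocalRing (invariantSubring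
      (IsLocalization.ringEquivOfRingEquiv (Localization.AtPrime 𝔭) (Localization.AtPrime 𝔭) τ H)) := by
  by_cases hne : IsLocalization.ringEquivOfRingEquiv (Localization.AtPrime 𝔭) (Localization.AtPrime 𝔭) τ H =
      RingEquiv.refl _
  · -- trivial action on `C_𝔭`: the invariants are everything
    have htop : invariantSubring
        (IsLocalization.ringEquivOfRingEquiv (Localization.AtPrime 𝔭) (Localization.AtPrime 𝔭) τ H) = ⊤ := by
      ext x
      rw [mem_invariantSubring_iff, hne]
      exact ⟨fun _ => trivial, fun _ => rfl⟩
    rw [htop]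
    exact IsRegularLocalRing.of_ringEquiv (R := Localization.AtPrime 𝔭) Subring.topEquiv.symm
  · have hI' : (augmentationIdeal
        (IsLocalization.ringEquivOfRingEquiv (Localization.AtPrime 𝔭) (Localization.AtPrime 𝔭) τ H)).IsPrincipal := by
      obtain ⟨ν, hν⟩ := hI
      rw [augmentationIdeal_ringEquivOfRingEquiv, hν]
      refine ⟨⟨algebraMap C (Localization.AtPrime 𝔭) ν, ?_⟩⟩
      change Ideal.map _ (Ideal.span {ν}) = Ideal.span {algebraMap C (Localization.AtPrime 𝔭) ν}
      rw [Ideal.map_span, Set.image_singleton]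
    exact (KiralyLutkebohmertRegularity_holds (Localization.AtPrime 𝔭) p _ hp
      (ringEquivOfRingEquiv_iterate_eq_self τ H hτp) hne hI').1

end StablePrime

end Summit.ResolutionOfSingularities.ResolutionOfSingularities.Theorems.WildQuotientResolution.S1.OneShotKill

end
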